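import Literature.NumberTheory.EllipticCurves.Disegni2020.PAdicBSDRankOneSplit
import Literature.NumberTheory.EllipticCurves.Disegni2020.PAdicBSDRankOneNonsplitDerived
import Literature.NumberTheory.EllipticCurves.PAdicHeightsLInvariantHoldsProofs
import HarnessLib

/-!
# DEDUP CLUSTER D1 (Disegni 2020, Thm. 4, second bullet ∘ Venerucci 2016 Thm. D): the valuation-form
# transcription `Disegni2020.padicBSD_rankOne_splitMult_of_irreducible` is DERIVED from the
# registry's fact of record A186 `Disegni2020.padicBSD_splitMult_rankOne` — theorems only, no fact

Topic `Literature/NumberTheory/EllipticCurves` (cluster `Disegni2020`). HONEST FRAMING (BSD rank-`≤ 1`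
residual cell `b2b-bsdres`, lane CLASS-CLOSURE, seat `cc-typer-6`; OWNERS.md §0 item 7, referee
R132.3, CITED-FACTS.md DEDUP CLUSTER D1): the sibling of `PAdicBSDRankOneNonsplitDerived.lean` for
the SPLIT clause. A186 (p249276, census-ctyper2) vendors, for `p ≥ 5` split multiplicative,
`E[p]` irreducible (Venerucci's standing hypothesis), analytic rank one: (1) `[T⁰]L = [T¹]L = 0`,
(2) the identity up to `ℚ^×`, (3) the EXACT identity
`ϖ·[T²]L·(log_p γ_cyc)²·#T² = 𝓛_p(E)·(#Ш_an·Reg_p(E,Dh)·∏ c_v)` given a second multiplicative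
prime. This seat's `padicBSD_rankOne_splitMult_of_irreducible` (p250455; same hypotheses, the second
multiplicative prime as a standing hypothesis) states `2 ≤ ord_T L` and, granted `Reg_p ≠ 0`,
`ord_T L = 2` with the VALUATION of (3). It follows from A186 and tree theorems: `𝓛_p(E) ≠ 0`
(`LInvariant_ne_zero_holds`, Barré-Sirieix–Diaz–Gramain–Philibert), `#Ш_an ≠ 0`
(`shaAn_ne_zero_of_isNewformOf`), `∏ c_v > 0`. So the registry's independent count for the second
bullet is ONE (A186); every consumer of p250455 (`X11b/RankOneSplitDisegni.lean`) is fed by A186.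
Nothing asserted; no definition; no named fact; no converse claimed.

* `Disegni2020.padicBSD_rankOne_splitMult_of_irreducible_of_primary :
  padicBSD_splitMult_rankOne → padicBSD_rankOne_splitMult_of_irreducible`.

References: [Disegni2020] Thm. 4 (§3.2), Prop. 4–5; [Venerucci2015] Thm. D, §1;
[BarreSirieixDiazGramainPhilibert1996Manin] Thm. 1; [SteinWuthrich2013] §4.2; CITED-FACTS.md §A
A183–A186.
-/

set_option autoImplicit false

noncomputable section

open scoped Classical MatrixGroups ModularForm

open CongruenceSubgroup WeierstrassCurve Literature.NumberTheory.EllipticCurves.ModularForms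
  Literature.NumberTheory.EllipticCurves.SteinWuthrich2013

namespace Literature.NumberTheory.EllipticCurves.Disegni2020

/-- **p250455 ⇐ A186 (DEDUP CLUSTER D1, split clause).** The valuation-form transcription
`padicBSD_rankOne_splitMult_of_irreducible` of Disegni 2020 Thm. 4 (second bullet, exact case) ∘
Venerucci 2016 Thm. D follows from the exact transcription `padicBSD_splitMult_rankOne` (the lane's
fact of record): the order clause `2 ≤ ord_T L` from its vanishing clause (1)
(`padicBSD_splitMult_rankOne.two_le_order`); exact order and the valuation identity from its exact
clause (3) with `𝓛_p(E) ≠ 0` (`LInvariant_ne_zero_holds`), `#Ш_an ≠ 0`, `∏ c_v ≠ 0` and the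
hypothesis `Reg_p ≠ 0`. No converse. [cite: Disegni2020, Thm. 4 second bullet (§3.2), Prop. 5]
[cite: Venerucci2015, Thm. D] [cite: BarreSirieixDiazGramainPhilibert1996Manin, Thm. 1] -/
theorem padicBSD_rankOne_splitMult_of_irreducible_of_primary (h : padicBSD_splitMult_rankOne) :
    padicBSD_rankOne_splitMult_of_irreducible := by
  intro W _ _ p _ hp5 hsplit hirr hm hr1 κ γ _ _ _ N _ f hf ϖ hϖ L hL Dq Dh hDh s hs
  obtain ⟨hvan, -, hexact⟩ := h W p hp5 Dq hirr hr1 f hf L hL Dh hDh ϖ hϖ s hs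
  refine ⟨padicBSD_splitMult_rankOne.two_le_order hvan, fun hReg ↦ ?_⟩
  -- the exact identity of A186, clause (3): the second multiplicative prime is the hypothesis `hm`
  have hid : (ϖ : ℚ_[p]) * PowerSeries.coeff 2 L * padicLog p (cyclotomicGenerator p) ^ 2 *
      (W.torsionOrder : ℚ_[p]) ^ 2 =
      LInvariant Dq * ((s : ℚ_[p]) * padicRegulator Dh * W.tamagawaProduct) := hexact hm
  -- the right-hand side is non-zero
  have hs0 : s ≠ 0 := by
    intro h0
    apply shaAn_ne_zero_of_isNewformOf hf
    rw [hs, h0, Rat.cast_zero]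
  have hsQ : ((s : ℚ) : ℚ_[p]) ≠ 0 := by exact_mod_cast hs0
  have hcp : (W.tamagawaProduct : ℚ_[p]) ≠ 0 := by exact_mod_cast (W.tamagawaProduct_pos').ne'
  have hLinv : LInvariant Dq ≠ 0 := W.LInvariant_ne_zero_holds Dq
  have hM : LInvariant Dq * (W.tamagawaProduct : ℚ_[p]) * padicRegulator Dh ≠ 0 :=
    mul_ne_zero (mul_ne_zero hLinv hcp) hReg
  have hR : LInvariant Dq * ((s : ℚ_[p]) * padicRegulator Dh * W.tamagawaProduct) ≠ 0 := by
    have : LInvariant Dq * ((s : ℚ_[p]) * padicRegulator Dh * W.tamagawaProduct) =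
        LInvariant Dq * (W.tamagawaProduct : ℚ_[p]) * padicRegulator Dh * (s : ℚ_[p]) := by ring
    rw [this]
    exact mul_ne_zero hM hsQ
  -- hence `[T²]L ≠ 0` and `ord_T L = 2`
  have hc2 : PowerSeries.coeff 2 L ≠ 0 := by
    intro h2
    apply hR
    rw [← hid, h2, mul_zero, zero_mul, zero_mul]
  have hord : L.order = ((2 : ℕ) : ℕ∞) := by
    rw [PowerSeries.order_eq_nat]
    refine ⟨hc2, fun i hi ↦ ?_⟩
    interval_cases i
    · simpa using hvan.1
    · exact hvan.2
  refine ⟨hord, ?_⟩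
  have hid' : ((ϖ : ℚ) : ℚ_[p]) * PowerSeries.coeff 2 L *
      (padicLog p (cyclotomicGenerator p) ^ 2 * (W.torsionOrder : ℚ_[p]) ^ 2) =
      LInvariant Dq * (W.tamagawaProduct : ℚ_[p]) * padicRegulator Dh * (s : ℚ_[p]) := by
    rw [← mul_assoc, hid]; ring
  rw [hid', Padic.valuation_mul hM hsQ, Padic.valuation_ratCast]

end Literature.NumberTheory.EllipticCurves.Disegni2020

end
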